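import Literature.AlgebraicGeometry.Motives.GrassmannianSectionsAffine
import Literature.AlgebraicGeometry.Motives.GrassmannianZariskiSheaf
import Literature.AlgebraicGeometry.Motives.GrassmannianMapLocalization
import Literature.AlgebraicGeometry.Modules.AffineVectorBundleSections
import Literature.AlgebraicGeometry.Modules.RankOneCocycle
import Literature.AlgebraicGeometry.Modules.VanishingLocusFiniteLocallyFree
import Mathlib.RingTheory.TensorProduct.Free
import HarnessLib

/-!
# The classifying morphism `T ⟶ Gr` of a rank-`k` quotient of `𝒪_T ⊗ M` generated by global sections

Topic `AlgebraicGeometry/Motives`; namespace `Literature.AlgebraicGeometry.Motives.Grassmannian`.  ONE DEFINITION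
(`sectionsMap`) + theorems; no instance, no notation, no named fact, no `sorry`.

The universal property of the Grassmannian ([GortzWedhorn2020, (8.4) (pp. 213–215)]: `Grass` represents «quotients of
`𝒪_S ⊗ M` locally free of rank `k`», glued from the affine case `G(k, A ⊗ M; A)` = Mathlib `Module.Grassmannian`), MODULE
SIDE → GRASSMANNIAN: let `M` be a free abelian group with basis `b : J → M`, `T` a scheme, `Q` an `𝒪_T`-module of
constant rank `k` (★ `HasRank`) and `q_j ∈ Γ(Q, T)`, `j ∈ J`, global sections GENERATING `Q` in the sense that the
SECTIONS MAPS

  `sectionsMap b Q q V = θ_V : Γ(T, V) ⊗_ℤ M → Γ(Q, V)`, `a ⊗ b_j ↦ a • q_j|_V` (§1),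

are surjective on the affine opens `V` (e.g. `q` = the images of the standard sections under an epimorphism `𝒪_T^J ↠ Q`,
★ `Morphisms.app_surjective_of_epi`).  Then:

* §2 along a basic open `D(r) ⊆ V` of an affine open, `θ_{D(r)} ∘ (res ⊗ 1) = res ∘ θ_V` (`map_sectionsMap`) and
  THE KERNELS LOCALISE, **`localized'_ker_sectionsMap`**: `(ker θ_V)_r = ker θ_{D(r)}` (`Γ(Q, D(r)) = Γ(Q, V)_r`, ★
  `isLocalizedModule_sectionsRestrictₗ`, [Hartshorne1977, II Lemma 5.3]; localisation is exact, Mathlib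
  `LinearMap.localized'_ker_eq_ker_localizedMap`);
* §3 **`finite_projective_rankAtStalk_quotient_ker`** — on an affine open `V`, `(Γ(T, V) ⊗ M) ⧸ ker θ_V` is finite
  projective of constant rank `k`, i.e. `ker θ_V ∈ G(k, Γ(T, V) ⊗ M; Γ(T, V))`: on the basic opens `D(rᵢ)` of a finite
  cover on which `Q` is framed by `k` sections (★ `exists_frameSystem_of_hasRank`, ★ `restrictTrivialisation`, ★
  `nonempty_basis_of_frame`) the quotient is `Γ(Q, D(rᵢ))`, free of rank `k`
  (`finite_projective_rankAtStalk_quotient_ker_of_frame`), and Grassmannian membership is Zariski-local (★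
  `finite_projective_rankAtStalk_quotient_of_localized'_eq`, the gluing lemma behind the sheaf property of `Gr`);
* §4 **`exists_affineFamily_ker_sectionsMap`** — the `ker θ_V` form an affine family compatible along basic opens (★
  `map_toSubmodule_eq_localized'`), hence, by ★ `existsUnique_hom_of_affineFamily` ((Q1) `GrassmannianSectionsAffine`),
  **`existsUnique_hom_ker_sectionsMap`**: THERE IS A UNIQUE `f : T ⟶ grassmannianScheme M k` WITH
  `evalAffine V (pointsEquiv f) = ker θ_V` FOR EVERY AFFINE OPEN `V` — the classifying morphism of the quotient `Q`
  (e.g. the morphism «Hilb → Grass» of F-5d, once the Hilbert functor's direct images are in place).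

Cell `hodgecm-mathlib` (D-0151), F-DAG hand (h4) «Grassmannian as a scheme» (B-p21 lineage), brick (Q2); count-neutral
Mathlib-side capital.  Nothing here is about HC; HC_CM is proved only modulo the 7 printed citations until rung 0 closes.

## References
* [GortzWedhorn2020] U. Görtz, T. Wedhorn, *Algebraic Geometry I*, 2nd ed. (2020), (8.4) (pp. 213–215) (the Grassmannian
  functor and the universal quotient), Thm. 7.12 (p. 185) with Cor. 7.17 (p. 188) (modules on standard opens).
* [Hartshorne1977] R. Hartshorne, *Algebraic Geometry* (1977), II Lemma 5.3 (p. 112), II Prop. 5.6 (p. 113).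
* [StacksProject] The Stacks project, Tag 089R (Grassmannians), Tag 00EO (the sheaf `M̃` on standard opens).
-/

noncomputable section

-- `TopCat.Presheaf`/`Scheme.Modules` are not reducible (as in Mathlib's `AlgebraicGeometry/Modules/Tilde.lean`).
set_option backward.isDefEq.respectTransparency false

namespace Literature.AlgebraicGeometry.Motives.Grassmannian

open CategoryTheory Opposite TensorProduct TopologicalSpace _root_.AlgebraicGeometry
open Literature.AlgebraicGeometry.Modules

universe u

variable {M : Type u} [AddCommGroup M] {k : ℕ} {J : Type u} (b : Module.Basis J ℤ M)
variable {T : Scheme.{u}} (Q : T.Modules) (q : J → Γ(Q, ⊤))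

/-! ## §1 The maps `θ_V : Γ(T, V) ⊗_ℤ M → Γ(Q, V)`, `a ⊗ b_j ↦ a • q_j|_V` -/

/-- **The sections map** `θ_V : Γ(T, V) ⊗_ℤ M → Γ(Q, V)` of a family of global sections `q_j ∈ Γ(Q, T)` indexed by a
basis `b` of the free abelian group `M`: the `Γ(T, V)`-linear map with `1 ⊗ b_j ↦ q_j|_V`.
[cite: GortzWedhorn2020, (8.4) (pp. 213–215)] -/
def sectionsMap (V : T.Opens) : Γ(T, V) ⊗[ℤ] M →ₗ[Γ(T, V)] Γ(Q, V) :=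
  (Algebra.TensorProduct.basis Γ(T, V) b).constr Γ(T, V) fun j => Q.presheaf.map (homOfLE le_top).op (q j)

/-- `θ_V (1 ⊗ b_j) = q_j|_V`. [cite: GortzWedhorn2020, (8.4) (pp. 213–215)] -/
@[simp]
theorem sectionsMap_one_tmul (V : T.Opens) (j : J) :
    sectionsMap b Q q V ((1 : Γ(T, V)) ⊗ₜ[ℤ] b j) = Q.presheaf.map (homOfLE le_top).op (q j) := by
  rw [sectionsMap, ← Algebra.TensorProduct.basis_apply, Module.Basis.constr_basis]

/-- `θ_V (a ⊗ m) = a • θ_V (1 ⊗ m)`. [cite: GortzWedhorn2020, (8.4) (pp. 213–215)] -/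
theorem sectionsMap_tmul (V : T.Opens) (a : Γ(T, V)) (m : M) :
    sectionsMap b Q q V (a ⊗ₜ[ℤ] m) = a • sectionsMap b Q q V ((1 : Γ(T, V)) ⊗ₜ[ℤ] m) := by
  rw [← map_smul, TensorProduct.smul_tmul', smul_eq_mul, mul_one]

/-- **Compatibility of the sections maps with restriction**: for opens `W ≤ V`,
`(θ_V x)|_W = θ_W ((res ⊗ 1) x)`. [cite: GortzWedhorn2020, (8.4) (pp. 213–215)] -/
theorem map_sectionsMap {V W : T.Opens} (i : W ≤ V) (x : Γ(T, V) ⊗[ℤ] M) :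
    Q.presheaf.map (homOfLE i).op (sectionsMap b Q q V x) =
      sectionsMap b Q q W ((T.presheaf.map (homOfLE i).op).hom.toIntAlgHom.toLinearMap.rTensor M x) := by
  -- the case `x = 1 ⊗ m`: two additive maps `M → Γ(Q, W)` agreeing on the basis `b`
  have h1 : ∀ m : M, Q.presheaf.map (homOfLE i).op (sectionsMap b Q q V ((1 : Γ(T, V)) ⊗ₜ[ℤ] m)) =
      sectionsMap b Q q W ((1 : Γ(T, W)) ⊗ₜ[ℤ] m) := by
    intro m
    let f₁ : M →ₗ[ℤ] Γ(Q, W) := (Q.presheaf.map (homOfLE i).op).hom.toIntLinearMap ∘ₗ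
      ((sectionsMap b Q q V).restrictScalars ℤ ∘ₗ TensorProduct.mk ℤ Γ(T, V) M 1)
    let f₂ : M →ₗ[ℤ] Γ(Q, W) := (sectionsMap b Q q W).restrictScalars ℤ ∘ₗ TensorProduct.mk ℤ Γ(T, W) M 1
    have hf : f₁ = f₂ := by
      refine b.ext fun j => ?_
      change Q.presheaf.map (homOfLE i).op (sectionsMap b Q q V ((1 : Γ(T, V)) ⊗ₜ[ℤ] b j)) =
        sectionsMap b Q q W ((1 : Γ(T, W)) ⊗ₜ[ℤ] b j)
      rw [sectionsMap_one_tmul, sectionsMap_one_tmul, ← CategoryTheory.comp_apply, ← Functor.map_comp]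
      rfl
    exact LinearMap.congr_fun hf m
  induction x using TensorProduct.induction_on with
  | zero => simp
  | tmul a m =>
    rw [LinearMap.rTensor_tmul, sectionsMap_tmul b Q q V a m, Scheme.Modules.map_smul, h1]
    exact (sectionsMap_tmul b Q q W _ m).symm
  | add x y hx hy => rw [map_add, map_add, hx, hy, map_add, map_add]

/-- The two spellings of `res ⊗ 1 : Γ(T, V) ⊗ M → Γ(T, D(r)) ⊗ M` agree. [cite: GortzWedhorn2020, (8.4) (pp. 213–215)] -/
theorem rTensor_algebraMap_apply {V : T.Opens} (r : Γ(T, V)) (x : Γ(T, V) ⊗[ℤ] M) :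
    AlgebraTensorModule.rTensor ℤ M (Algebra.linearMap Γ(T, V) Γ(T, T.basicOpen r)) x =
      (T.presheaf.map (homOfLE (T.basicOpen_le r)).op).hom.toIntAlgHom.toLinearMap.rTensor M x := by
  induction x using TensorProduct.induction_on with
  | zero => simp
  | tmul a m => rfl
  | add x y hx hy => rw [map_add, map_add, hx, hy]

/-! ## §2 Along a basic open `D(r) ⊆ V` of an affine open: the kernels localise -/

section BasicOpen

variable {V : T.Opens} (hV : IsAffineOpen V) (r : Γ(T, V))

include hV in
/-- **The kernels of the sections maps localise** (`Q` affine-localizing, e.g. quasi-coherent): `(ker θ_V)_r = ker θ_{D(r)}`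
inside `Γ(T, D(r)) ⊗ M = (Γ(T, V) ⊗ M)_r` — localisation is exact (Mathlib `LinearMap.localized'_ker_eq_ker_localizedMap`)
and `Γ(Q, D(r)) = Γ(Q, V)_r` (★ `isLocalizedModule_sectionsRestrictₗ`, [Hartshorne1977, II Lemma 5.3]).
[cite: Hartshorne1977, II Lemma 5.3 (p. 112)] [cite: GortzWedhorn2020, (8.4) (pp. 213–215)] -/
theorem localized'_ker_sectionsMap (hQ : IsAffineLocalizing Q) [IsLocalization.Away r Γ(T, T.basicOpen r)] :
    (LinearMap.ker (sectionsMap b Q q V)).localized' Γ(T, T.basicOpen r) (.powers r)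
        (AlgebraTensorModule.rTensor ℤ M (Algebra.linearMap Γ(T, V) Γ(T, T.basicOpen r))) =
      LinearMap.ker (sectionsMap b Q q (T.basicOpen r)) := by
  letI : Module Γ(T, V) Γ(Q, T.basicOpen r) := Module.compHom _ (algebraMap Γ(T, V) Γ(T, T.basicOpen r))
  haveI : IsScalarTower Γ(T, V) Γ(T, T.basicOpen r) Γ(Q, T.basicOpen r) :=
    IsScalarTower.of_algebraMap_smul fun _ _ => rfl
  haveI hloc : IsLocalizedModule (.powers r) (sectionsRestrictₗ Q r) :=
    isLocalizedModule_sectionsRestrictₗ Q hV r hQ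
  -- `θ_{D(r)} ∘ (res ⊗ 1) = res ∘ θ_V`
  have hcomp : (sectionsMap b Q q (T.basicOpen r)).restrictScalars Γ(T, V) ∘ₗ
        AlgebraTensorModule.rTensor ℤ M (Algebra.linearMap Γ(T, V) Γ(T, T.basicOpen r)) =
      sectionsRestrictₗ Q r ∘ₗ sectionsMap b Q q V := by
    refine LinearMap.ext fun x => ?_
    change sectionsMap b Q q (T.basicOpen r)
        (AlgebraTensorModule.rTensor ℤ M (Algebra.linearMap Γ(T, V) Γ(T, T.basicOpen r)) x) =
      Q.presheaf.map (homOfLE (T.basicOpen_le r)).op (sectionsMap b Q q V x)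
    rw [rTensor_algebraMap_apply, map_sectionsMap]
  rw [LinearMap.localized'_ker_eq_ker_localizedMap (Γ(T, T.basicOpen r)) (.powers r)
    (AlgebraTensorModule.rTensor ℤ M (Algebra.linearMap Γ(T, V) Γ(T, T.basicOpen r))) (sectionsRestrictₗ Q r)]
  have hmap : IsLocalizedModule.map (.powers r)
      (AlgebraTensorModule.rTensor ℤ M (Algebra.linearMap Γ(T, V) Γ(T, T.basicOpen r))) (sectionsRestrictₗ Q r)
        (sectionsMap b Q q V) = (sectionsMap b Q q (T.basicOpen r)).restrictScalars Γ(T, V) :=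
    IsLocalizedModule.linearMap_ext (.powers r)
      (AlgebraTensorModule.rTensor ℤ M (Algebra.linearMap Γ(T, V) Γ(T, T.basicOpen r))) (sectionsRestrictₗ Q r)
      (by rw [IsLocalizedModule.map_comp, hcomp])
  rw [hmap]
  ext x
  simp only [LinearMap.mem_ker, LinearMap.extendScalarsOfIsLocalization_apply', LinearMap.restrictScalars_apply]

/-! ## §3 On an affine open, `ker θ_V` is a point of the Grassmannian -/

/-- **A framed piece**: over an open `W` where `Q` has a frame with `k` elements and `θ_W` is surjective, the quotient
`(Γ(T, W) ⊗ M) ⧸ ker θ_W ≅ Γ(Q, W)` is finite free of rank `k` (the basis sections of the frame, ★ `nonempty_basis_of_frame`),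
so finite projective with `rankAtStalk ≡ k`. [cite: GortzWedhorn2020, (8.4) (pp. 213–215)] -/
theorem finite_projective_rankAtStalk_quotient_ker_of_frame {W : T.Opens} {I : Type u} [Fintype I]
    (e : SheafOfModules.free I ≅ Q.over W) (hk : Fintype.card I = k)
    (hsurj : Function.Surjective (sectionsMap b Q q W)) :
    Module.Finite Γ(T, W) ((Γ(T, W) ⊗[ℤ] M) ⧸ LinearMap.ker (sectionsMap b Q q W)) ∧
      Module.Projective Γ(T, W) ((Γ(T, W) ⊗[ℤ] M) ⧸ LinearMap.ker (sectionsMap b Q q W)) ∧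
      ∀ p, Module.rankAtStalk (R := Γ(T, W)) ((Γ(T, W) ⊗[ℤ] M) ⧸ LinearMap.ker (sectionsMap b Q q W)) p = k := by
  obtain ⟨bQ⟩ := nonempty_basis_of_frame e
  let e' := (sectionsMap b Q q W).quotKerEquivOfSurjective hsurj
  haveI : Module.Free Γ(T, W) Γ(Q, W) := Module.Free.of_basis bQ
  haveI : Module.Finite Γ(T, W) Γ(Q, W) := Module.Finite.of_basis bQ
  refine ⟨Module.Finite.equiv e'.symm, Module.Projective.of_equiv e'.symm, fun p => ?_⟩
  -- a prime ideal exists, so the ring of sections is nontrivial (`StrongRankCondition`)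
  haveI : Nontrivial Γ(T, W) := by
    by_contra h
    rw [not_nontrivial_iff_subsingleton] at h
    exact p.2.ne_top (Ideal.eq_top_iff_one _ |>.mpr (by rw [Subsingleton.elim (1 : Γ(T, W)) 0]; exact p.asIdeal.zero_mem))
  rw [Module.rankAtStalk_eq_of_equiv e', Module.rankAtStalk_eq_finrank_of_free]
  exact (Module.finrank_eq_card_basis bQ).trans hk

include hV in
/-- **On an affine open `V`, `(Γ(T, V) ⊗ M) ⧸ ker θ_V` is finite projective of constant rank `k`** when `Q` has rank `k`
and the sections maps are surjective on the affine opens inside `V`: cover `V` by finitely many basic opens `D(rᵢ)` on which `Q`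
is framed by `k` sections (★ `exists_frameSystem_of_hasRank`, `restrictTrivialisation`); there the quotient is free of rank `k`
(`finite_projective_rankAtStalk_quotient_ker_of_frame`) and it is the localisation of the quotient over `V`
(`localized'_ker_sectionsMap`); conclude by the Zariski-local criterion ★ `finite_projective_rankAtStalk_quotient_of_localized'_eq`.
[cite: GortzWedhorn2020, (8.4) (pp. 213–215)] [cite: StacksProject, Tag 00EO] -/
theorem finite_projective_rankAtStalk_quotient_ker (hQ : HasRank Q k)
    (hgen : ∀ W : T.Opens, IsAffineOpen W → W ≤ V → Function.Surjective (sectionsMap b Q q W)) :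
    Module.Finite Γ(T, V) ((Γ(T, V) ⊗[ℤ] M) ⧸ LinearMap.ker (sectionsMap b Q q V)) ∧
      Module.Projective Γ(T, V) ((Γ(T, V) ⊗[ℤ] M) ⧸ LinearMap.ker (sectionsMap b Q q V)) ∧
      ∀ p, Module.rankAtStalk (R := Γ(T, V)) ((Γ(T, V) ⊗[ℤ] M) ⧸ LinearMap.ker (sectionsMap b Q q V)) p = k := by
  classical
  obtain ⟨F, hF⟩ := exists_frameSystem_of_hasRank hQ
  have hQal : IsAffineLocalizing Q := isAffineLocalizing_of_isFiniteLocallyFree F.isFiniteLocallyFree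
  -- basic opens `D(r_y) ∋ y` inside the frame opens
  choose rr hrU hry using fun y : V => hV.exists_basicOpen_le ⟨(y : T), F.mem y⟩ y.2
  have hspan : Ideal.span (Set.range rr) = ⊤ := by
    rw [← hV.iSup_basicOpen_eq_self_iff]
    refine le_antisymm (iSup_le fun f => T.basicOpen_le _) fun y hy => ?_
    exact Opens.mem_iSup.mpr ⟨⟨rr ⟨y, hy⟩, ⟨y, hy⟩, rfl⟩, hry ⟨y, hy⟩⟩
  obtain ⟨s', hs'sub, hs'⟩ := (Ideal.span_eq_top_iff_finite _).mp hspan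
  haveI : ∀ i : (s' : Set Γ(T, V)), IsLocalization.Away (i : Γ(T, V)) Γ(T, T.basicOpen (i : Γ(T, V))) :=
    fun i => hV.isLocalization_basicOpen _
  -- the framed pieces
  have hpiece : ∀ i : (s' : Set Γ(T, V)),
      Module.Finite Γ(T, T.basicOpen (i : Γ(T, V)))
          ((Γ(T, T.basicOpen (i : Γ(T, V))) ⊗[ℤ] M) ⧸ LinearMap.ker (sectionsMap b Q q (T.basicOpen (i : Γ(T, V))))) ∧
        Module.Projective Γ(T, T.basicOpen (i : Γ(T, V)))
          ((Γ(T, T.basicOpen (i : Γ(T, V))) ⊗[ℤ] M) ⧸ LinearMap.ker (sectionsMap b Q q (T.basicOpen (i : Γ(T, V))))) ∧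
        ∀ p, Module.rankAtStalk (R := Γ(T, T.basicOpen (i : Γ(T, V))))
          ((Γ(T, T.basicOpen (i : Γ(T, V))) ⊗[ℤ] M) ⧸ LinearMap.ker (sectionsMap b Q q (T.basicOpen (i : Γ(T, V))))) p = k := by
    intro i
    obtain ⟨y, hy⟩ := hs'sub i.2
    haveI : Fintype (F.I y) := Fintype.ofEquiv _ (F.enum y).symm
    have hle : T.basicOpen (i : Γ(T, V)) ≤ F.U y := by
      rw [← hy]
      exact hrU y
    refine finite_projective_rankAtStalk_quotient_ker_of_frame b Q q
      (SheafOfModules.restrictTrivialisation (R := T.ringCatSheaf) (homOfLE hle) (F.frame y)) ?_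
      (hgen _ (hV.basicOpen _) (T.basicOpen_le _))
    rw [Fintype.card_congr (F.enum y), Fintype.card_fin, hF y]
  exact finite_projective_rankAtStalk_quotient_of_localized'_eq (s := (s' : Set Γ(T, V)))
    (Rₚ := fun i => Γ(T, T.basicOpen (i : Γ(T, V))))
    (Mₚ := fun i => Γ(T, T.basicOpen (i : Γ(T, V))) ⊗[ℤ] M)
    (g := fun i => AlgebraTensorModule.rTensor ℤ M (Algebra.linearMap Γ(T, V) Γ(T, T.basicOpen (i : Γ(T, V)))))
    hs' (fun i => LinearMap.ker (sectionsMap b Q q (T.basicOpen (i : Γ(T, V)))))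
    (LinearMap.ker (sectionsMap b Q q V)) (fun i => localized'_ker_sectionsMap b Q q hV (i : Γ(T, V)) hQal) k
    (fun i => (hpiece i).1) (fun i => (hpiece i).2.1) (fun i => (hpiece i).2.2)

end BasicOpen

/-! ## §4 The affine family of kernels and the classifying morphism -/

/-- **The kernels `ker θ_V` form a compatible affine family of rank-`k` quotients** (`Q` of rank `k`, the sections maps
surjective on affine opens — e.g. the `q_j` the images of the standard sections under an epimorphism `𝒪_T^J ↠ Q`, by
★ `app_surjective_of_epi`): there are `N_V ∈ G(k, Γ(T, V) ⊗ M; Γ(T, V))` with `N_V = ker θ_V` for every affine open `V`,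
compatible with restriction to basic opens in the sense of ★ `existsUnique_of_affineFamily` (by `localized'_ker_sectionsMap`
and ★ `map_toSubmodule_eq_localized'`). [cite: GortzWedhorn2020, (8.4) (pp. 213–215)] -/
theorem exists_affineFamily_ker_sectionsMap (hQ : HasRank Q k)
    (hgen : ∀ W : T.Opens, IsAffineOpen W → Function.Surjective (sectionsMap b Q q W)) :
    ∃ N : ∀ V : T.affineOpens, Module.Grassmannian Γ(T, V) (Γ(T, V) ⊗[ℤ] M) k,
      (∀ V, (N V).toSubmodule = LinearMap.ker (sectionsMap b Q q V)) ∧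
      ∀ (V : T.affineOpens) (r : Γ(T, V)),
        N ⟨T.basicOpen r, V.2.basicOpen r⟩ =
          Module.Grassmannian.map (T.presheaf.map (homOfLE (T.basicOpen_le r)).op).hom.toIntAlgHom (N V) := by
  have h := fun V : T.affineOpens =>
    finite_projective_rankAtStalk_quotient_ker b Q q V.2 hQ fun W hW _ => hgen W hW
  obtain ⟨F, -⟩ := exists_frameSystem_of_hasRank hQ
  have hQal : IsAffineLocalizing Q := isAffineLocalizing_of_isFiniteLocallyFree F.isFiniteLocallyFree
  refine ⟨fun V => ⟨LinearMap.ker (sectionsMap b Q q V), (h V).1, (h V).2.1, (h V).2.2⟩, fun V => rfl, fun V r => ?_⟩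
  haveI : IsLocalization.Away r Γ(T, T.basicOpen r) := V.2.isLocalization_basicOpen r
  ext : 1
  have hφ : (T.presheaf.map (homOfLE (T.basicOpen_le r)).op).hom.toIntAlgHom =
      IsScalarTower.toAlgHom ℤ Γ(T, V) Γ(T, T.basicOpen r) := AlgHom.ext fun _ => rfl
  rw [hφ, map_toSubmodule_eq_localized' (.powers r)]
  exact (localized'_ker_sectionsMap b Q q V.2 r hQal).symm

section Scheme

variable (M k) [(grassmannianSheaf M k).obj.IsRepresentable]

/-- **The classifying morphism of a rank-`k` quotient of `𝒪_T ⊗ M`.**  Let `Q` be an `𝒪_T`-module of constant rank `k`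
generated by global sections `q_j`, `j ∈ J` (a basis of the free abelian group `M`), in the sense that the sections maps
`θ_W : Γ(T, W) ⊗ M → Γ(Q, W)` are surjective on affine opens `W` (e.g. `𝒪_T^J ↠ Q` an epimorphism, ★ `app_surjective_of_epi`).
Then there is a UNIQUE morphism `f : T ⟶ grassmannianScheme M k` whose value on every affine open `V` is the quotient
`Γ(Q, V)` of `Γ(T, V) ⊗ M`, i.e. `evalAffine V (pointsEquiv f) = ker θ_V` — the universal property of the Grassmannian
([GortzWedhorn2020, (8.4) (pp. 213–215)]: `Grass` represents «locally free rank-`k` quotients of `𝒪_S ⊗ M`») in the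
algebraic currency of ★ `existsUnique_hom_of_affineFamily`. [cite: GortzWedhorn2020, (8.4) (pp. 213–215)]
[cite: StacksProject, Tag 089R] -/
theorem existsUnique_hom_ker_sectionsMap (hQ : HasRank Q k)
    (hgen : ∀ W : T.Opens, IsAffineOpen W → Function.Surjective (sectionsMap b Q q W)) :
    ∃! f : T ⟶ grassmannianScheme M k, ∀ V : T.affineOpens,
      (evalAffine V.2 (pointsEquiv M k T f)).toSubmodule = LinearMap.ker (sectionsMap b Q q V) := by
  obtain ⟨N, hN, hcompat⟩ := exists_affineFamily_ker_sectionsMap b Q q hQ hgen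
  obtain ⟨f, hf, huniq⟩ := existsUnique_hom_of_affineFamily M k N hcompat
  refine ⟨f, fun V => by rw [hf V, hN V], fun g hg => huniq g fun V => ?_⟩
  ext : 1
  rw [hg V, hN V]

end Scheme

end Literature.AlgebraicGeometry.Motives.Grassmannian

end
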